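import Summits.ResolutionOfSingularities.ResolutionOfSingularities.Theorems.PurelyInseparableDim4UnitClassOrder
import Summits.ResolutionOfSingularities.ResolutionOfSingularities.Theorems.PurelyInseparableDim4UnitClassTransferRel
import Summits.ResolutionOfSingularities.ResolutionOfSingularities.Theorems.PurelyInseparableDim4ResConeDiagonalLinearPart
import Summits.ResolutionOfSingularities.ResolutionOfSingularities.Theorems.PurelyInseparableDim4ResConeShadeOneStep
import Summits.ResolutionOfSingularities.ResolutionOfSingularities.Theorems.PurelyInseparableDim4TschirnhausJetStep
import HarnessLib
import HarnessLib.Audit.Tags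

/-!
# Purely inseparable four-folds — K24a-R1′: the GRADED TRANSFER of the two-slot readings through the framed swap
# relation of a rotation step (shadow bookkeeping of the 05:02Z audit) (cell `res-dim4-pi`, K2(p) lane, slice B
# brick K24a, part R1c, file 3)

[OURS · counted 0 · cell `res-dim4-pi` · K2(p) lane (holder res-dim4-p-12; R1′(β) route 2026-08-29 04:06Z); seat
res-dim4-p-1 g4 over res-dim4-p-7 g4's graded transfer `SwapNorm.coeff_of_unitClass_rel` (`…UnitClassTransferRel`)
and frame-order lemmas `coeff_linear_eq_zero_of_straight`, `coeff_quadratic_eq_zero_of_tschirnhaus`,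
`three_le_degree_of_frames` (`…UnitClassOrder`).]  Nothing here proves K2(p)/K2(5), `NoIsolatedTrap p p` or
resolution of singularities in dimension ≥ 4 / characteristic `p`.  AI kernel work, weaker than expert review.

SETTING (abstract; instantiated by file 4 on the chain).  Letters `a, f, o, ν` pairwise distinct: `a` = the free
letter of the framed REAL child `P = S̃_A` (boundary `r = e_f + e_o + e_ν`), `f` = the free letter of the framed SWAP
PARTNER `Q = S̃_B` (boundary `r♭ = e_a + e_o + e_ν`); a unit-class relation `Q = clean (U⁵·Θ(P)) + E` along
`Equiv.swap a f` (file 2) whose correction `G` has pure-slot part of degree `≥ 3` (§2).  A-side structural zeros: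
`x^r ∣ P`, relative degree `≤ 2` vanishes (order `6`), relative degree `3` off `x_a³` vanishes (straight frame).

* §1 **`transfer_coeff`** — for a relative exponent `n₀` (`|n₀| ≤ 6`, `n₀ a ≤ 1`, `n₀ ν ≤ 1`) whose COMPONENTWISE-LOWER
  readings of relative degree `≥ 4` vanish (`H4`) and, when `|n₀| = 6`, whose degree-3 lower exponents shifted by
  `x_a` vanish (`H3`): `coeff_{(r+n₀)♭} Q = U(0)⁵ · ∏ e_i(0)^{…} · coeff_{r+n₀} P`; `transfer_ne` (contrapositive use).
* §2 **`three_le_degree_of_framed_rel`** — `s = 3` for `G` when both framed states are straight with Tschirnhaus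
  datum vanishing in relative degree `4` (res-dim4-p-7's (b′) + (b″)).
* §3 the instances of the rotating game: `transfer_deg_four` (|n₀| = 4: CLEAN), `transfer_two_three` (`2x+3y`:
  live shadow `x+3y`, zero `2x+2y`), `transfer_two_four` (`2x+4y`: live `x+3y, x+4y, 2x+3y, Y+x+2y, Y+2x+y`;
  zeros `2x+2y`, `4y`, `Y+3y`).

[cite: CossartJannsenSaito2020, Thm. 3.14] [cite: Hauser2010, §6 (failure of maximal contact; coordinate changes)]
bears_on: LADDER-RESOLUTION:D157-DOOR2 (res-dim4-pi · K2(p) · slice B · K24a-R1c); supports stmt-…-16155 (helper).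
-/

set_option linter.dupNamespace false -- mandated namespace of this single-conjunct summit

noncomputable section

namespace Summit.ResolutionOfSingularities.ResolutionOfSingularities.Theorems.PIDim4

namespace ResCone

open MvPolynomial Finset
open Literature.AlgebraicGeometry.Resolution
open Literature.AlgebraicGeometry.Resolution.Hauser2010
open Literature.AlgebraicGeometry.Resolution.HauserPerlega2019

variable {K : Type} [Field K]

/-! ## §0 Exponent bookkeeping -/

section Exponents

variable {a f o ν : Fin 4}

/-- The swap of the boundary-plus-exponent: `(e_f + e_o + e_ν + n₀)♭ = e_a + e_o + e_ν + n₀♭`. [folklore] -/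
theorem mapDomain_swap_boundary_add (hao : a ≠ o) (haν : a ≠ ν) (hfo : f ≠ o) (hfν : f ≠ ν) (n₀ : Fin 4 →₀ ℕ) :
    (Finsupp.single f 1 + Finsupp.single o 1 + Finsupp.single ν 1 + n₀).mapDomain (Equiv.swap a f).symm =
      Finsupp.single a 1 + Finsupp.single o 1 + Finsupp.single ν 1 + n₀.mapDomain (Equiv.swap a f).symm := by
  rw [Finsupp.mapDomain_add, Finsupp.mapDomain_add, Finsupp.mapDomain_add, Finsupp.mapDomain_single,
    Finsupp.mapDomain_single, Finsupp.mapDomain_single, Equiv.symm_swap, Equiv.swap_apply_right,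
    Equiv.swap_apply_of_ne_of_ne hao.symm hfo.symm, Equiv.swap_apply_of_ne_of_ne haν.symm hfν.symm]

/-- The swap of the boundary: `(e_f + e_o + e_ν)♭ = e_a + e_o + e_ν`. [folklore] -/
theorem mapDomain_swap_boundary (hao : a ≠ o) (haν : a ≠ ν) (hfo : f ≠ o) (hfν : f ≠ ν) :
    (Finsupp.single f 1 + Finsupp.single o 1 + Finsupp.single ν 1 : Fin 4 →₀ ℕ).mapDomain (Equiv.swap a f).symm =
      Finsupp.single a 1 + Finsupp.single o 1 + Finsupp.single ν 1 := by
  rw [Finsupp.mapDomain_add, Finsupp.mapDomain_add, Finsupp.mapDomain_single, Finsupp.mapDomain_single,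
    Finsupp.mapDomain_single, Equiv.symm_swap, Equiv.swap_apply_right, Equiv.swap_apply_of_ne_of_ne hao.symm hfo.symm,
    Equiv.swap_apply_of_ne_of_ne haν.symm hfν.symm]

/-- `(x·e_f + y·e_o)♭ = x·e_a + y·e_o`. [folklore] -/
theorem mapDomain_swap_fo (hao : a ≠ o) (hfo : f ≠ o) (x y : ℕ) :
    (Finsupp.single f x + Finsupp.single o y : Fin 4 →₀ ℕ).mapDomain (Equiv.swap a f).symm =
      Finsupp.single a x + Finsupp.single o y := by
  rw [Finsupp.mapDomain_add, Finsupp.mapDomain_single, Finsupp.mapDomain_single, Equiv.symm_swap,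
    Equiv.swap_apply_right, Equiv.swap_apply_of_ne_of_ne hao.symm hfo.symm]

/-- `(x·e_o + y·e_f)♭ = x·e_o + y·e_a`. [folklore] -/
theorem mapDomain_swap_of (hao : a ≠ o) (hfo : f ≠ o) (x y : ℕ) :
    (Finsupp.single o x + Finsupp.single f y : Fin 4 →₀ ℕ).mapDomain (Equiv.swap a f).symm =
      Finsupp.single o x + Finsupp.single a y := by
  rw [add_comm, mapDomain_swap_fo hao hfo, add_comm]
/-- A single letter `i ∉ {a, f}` is fixed by `♭`. [folklore] -/
theorem mapDomain_swap_single_of_ne {i : Fin 4} (hia : i ≠ a) (hif : i ≠ f) (x : ℕ) :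
    (Finsupp.single i x : Fin 4 →₀ ℕ).mapDomain (Equiv.swap a f).symm = Finsupp.single i x := by
  rw [Finsupp.mapDomain_single, Equiv.symm_swap, Equiv.swap_apply_of_ne_of_ne hia hif]

/-- `(x·e_a)♭ = x·e_f`. [folklore] -/
theorem mapDomain_swap_single_left (a f : Fin 4) (x : ℕ) :
    (Finsupp.single a x : Fin 4 →₀ ℕ).mapDomain (Equiv.swap a f).symm = Finsupp.single f x := by
  rw [Finsupp.mapDomain_single, Equiv.symm_swap, Equiv.swap_apply_left]
/-- An exponent below `x·e_i + y·e_k` (`i ≠ k`) is `(m i)·e_i + (m k)·e_k` with `m i ≤ x`, `m k ≤ y`. [folklore] -/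
theorem eq_of_le_two_single {i k : Fin 4} (hik : i ≠ k) {x y : ℕ} {m : Fin 4 →₀ ℕ}
    (hm : m ≤ Finsupp.single i x + Finsupp.single k y) :
    m = Finsupp.single i (m i) + Finsupp.single k (m k) ∧ m i ≤ x ∧ m k ≤ y := by
  refine ⟨?_, ?_, ?_⟩
  · ext l
    by_cases hli : l = i
    · subst hli; simp [hik]
    by_cases hlk : l = k
    · subst hlk; simp [hik]
    have h := hm l
    simp only [Finsupp.add_apply, Finsupp.single_apply, Ne.symm hli, Ne.symm hlk, if_false, add_zero,
      Nat.le_zero] at h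
    simp [h, Ne.symm hli, Ne.symm hlk]
  · simpa [hik] using hm i
  · simpa [hik.symm] using hm k

end Exponents

/-! ## §1 The graded transfer with shadow bookkeeping -/

section Transfer

/-- **THE GRADED TRANSFER OF ONE READING** (K24a-R1c; setting in the module docstring).  Along the framed swap
relation `Q = clean (U⁵·Θ(P)) + E` (`Θ` unit-class along `swap a f`, B-free letter `f`, pure-slot part of `G` of
degree `≥ 3`, `E ∈ 𝔪^M`, `M ≥ 10`), for a relative exponent `n₀` with `|n₀| ≤ 6`, `n₀ a ≤ 1`, `n₀ ν ≤ 1` whose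
lower shadows vanish (`H4`: componentwise-lower of relative degree `≥ 4`; `H3`: degree-3 lower shifted by `x_a`,
only when `|n₀| = 6`) — the remaining shadows being the structural zeros `hZ2` (relative degree `≤ 2`) and `hZ3`
(relative degree `3`, `a`-exponent `≤ 2`) — the partner's coefficient at `(r + n₀)♭` is a unit multiple of the real
child's coefficient at `r + n₀`. [OURS over res-dim4-p-7's `SwapNorm.coeff_of_unitClass_rel`]
[cite: CossartJannsenSaito2020, Thm. 3.14] -/
theorem transfer_coeff {a f o ν : Fin 4} (haf : a ≠ f) (hao : a ≠ o) (haν : a ≠ ν) (hfν : f ≠ ν) (hoν : o ≠ ν)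
    {P Q : MvPolynomial (Fin 4) K} {r : Fin 4 →₀ ℕ}
    (hr : r = Finsupp.single f 1 + Finsupp.single o 1 + Finsupp.single ν 1)
    {Θ e : Fin 4 → MvPolynomial (Fin 4) K} {G U E : MvPolynomial (Fin 4) K} {M : ℕ}
    (hΘi : ∀ i, i ≠ f → Θ (Equiv.swap a f i) = X i * e i) (hΘf : Θ (Equiv.swap a f f) = X f * e f + G)
    (hG1 : coeff (Finsupp.single f 1) G = 0) (hG3 : ∀ dd ∈ G.support, dd f = 0 → 3 ≤ dd.degree)
    (hE : E ∈ originIdeal K ^ M) (hrel : Q = deletePthPowers 5 (U ^ 5 * aeval Θ P) + E)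
    (hdivP : ∀ m ∈ P.support, r ≤ m) (hZ2 : ∀ m : Fin 4 →₀ ℕ, m.degree ≤ 2 → coeff (r + m) P = 0)
    (hZ3 : ∀ m : Fin 4 →₀ ℕ, m.degree = 3 → m a ≤ 2 → coeff (r + m) P = 0)
    {n₀ : Fin 4 →₀ ℕ} (hn₀ : n₀.degree ≤ 6) (hn₀a : n₀ a ≤ 1) (hn₀ν : n₀ ν ≤ 1) (hM : 10 ≤ M)
    (H4 : ∀ m₀ : Fin 4 →₀ ℕ, m₀ ≤ n₀ → m₀ ≠ n₀ → 4 ≤ m₀.degree → coeff (r + m₀) P = 0)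
    (H3 : n₀.degree = 6 → ∀ m₀ : Fin 4 →₀ ℕ, m₀ ≤ n₀ → m₀.degree = 3 →
      coeff (r + (m₀ + Finsupp.single a 1)) P = 0) :
    coeff ((r + n₀).mapDomain (Equiv.swap a f).symm) Q =
      constantCoeff (U ^ 5) * (∏ i, constantCoeff (e i) ^ (r + n₀) (Equiv.swap a f i)) * coeff (r + n₀) P := by
  classical
  have hπf : Equiv.swap a f f = a := Equiv.swap_apply_right a f
  have hra : r a = 0 := by rw [hr]; simp [haf, hao, haν]
  have hrν : r ν = 1 := by rw [hr]; simp [hfν, hoν]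
  have hrdeg : r.degree = 3 := by rw [hr, map_add, map_add]; simp
  refine SwapNorm.coeff_of_unitClass_rel 5 hΘi hΘf hG1 hG3 (by norm_num) hE hrel ?_ ?_ ?_
  · -- the shadows
    intro m₀ j hm₀ hdeg hne
    rw [hπf] at hne ⊢
    by_contra hc
    have hrm' : r ≤ m₀ + Finsupp.single a j := hdivP _ (mem_support_iff.mpr hc)
    have hrm : r ≤ m₀ := fun i => by
      by_cases hia : i = a
      · rw [hia, hra]; exact Nat.zero_le _
      · have h := hrm' i
        rwa [Finsupp.add_apply, Finsupp.single_apply, if_neg (Ne.symm hia), add_zero] at h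
    obtain ⟨m, rfl⟩ : ∃ m, m₀ = r + m := ⟨m₀ - r, (add_tsub_cancel_of_le hrm).symm⟩
    have hm : m ≤ n₀ := (add_le_add_iff_left r).mp hm₀
    have hma : m a ≤ 1 := (hm a).trans hn₀a
    rw [map_add, map_add, hrdeg] at hdeg
    rw [add_assoc] at hc hne
    have key : m.degree + j ≤ 2 ∨ (m.degree + j = 3 ∧ j ≤ 1) ∨ (4 ≤ m.degree ∧ j = 0) ∨
        (m.degree = 3 ∧ j = 1 ∧ n₀.degree = 6) := by omega
    rcases key with h | ⟨h, hj⟩ | ⟨h, hj⟩ | ⟨h, hj, h6⟩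
    · exact hc (hZ2 _ (by rw [map_add, Finsupp.degree_single]; exact h))
    · exact hc (hZ3 _ (by rw [map_add, Finsupp.degree_single]; exact h)
        (by rw [Finsupp.add_apply, Finsupp.single_eq_same]; omega))
    · subst hj
      rw [Finsupp.single_zero, add_zero] at hc hne
      exact hc (H4 m hm (fun h' => hne (by rw [h'])) h)
    · subst hj
      exact hc (H3 h6 m hm h)
  · rw [map_add, hrdeg]; omega
  · refine not_isPthPowerExponent_of_not_dvd (i := ν) ?_
    rw [mapDomain_symm_apply, Equiv.swap_apply_of_ne_of_ne haν.symm hfν.symm, Finsupp.add_apply, hrν]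
    omega

/-- `transfer_coeff`, contrapositive use: a NONZERO partner reading at `(r + n₀)♭` forces a nonzero real-child
reading at `r + n₀` (the unit constant is nonzero). [OURS] [cite: CossartJannsenSaito2020, Thm. 3.14] -/
theorem transfer_ne {a f o ν : Fin 4} (haf : a ≠ f) (hao : a ≠ o) (haν : a ≠ ν) (hfν : f ≠ ν) (hoν : o ≠ ν)
    {P Q : MvPolynomial (Fin 4) K} {r : Fin 4 →₀ ℕ}
    (hr : r = Finsupp.single f 1 + Finsupp.single o 1 + Finsupp.single ν 1)
    {Θ e : Fin 4 → MvPolynomial (Fin 4) K} {G U E : MvPolynomial (Fin 4) K} {M : ℕ}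
    (hΘi : ∀ i, i ≠ f → Θ (Equiv.swap a f i) = X i * e i) (hΘf : Θ (Equiv.swap a f f) = X f * e f + G)
    (hG1 : coeff (Finsupp.single f 1) G = 0) (hG3 : ∀ dd ∈ G.support, dd f = 0 → 3 ≤ dd.degree)
    (hE : E ∈ originIdeal K ^ M) (hrel : Q = deletePthPowers 5 (U ^ 5 * aeval Θ P) + E)
    (hdivP : ∀ m ∈ P.support, r ≤ m) (hZ2 : ∀ m : Fin 4 →₀ ℕ, m.degree ≤ 2 → coeff (r + m) P = 0)
    (hZ3 : ∀ m : Fin 4 →₀ ℕ, m.degree = 3 → m a ≤ 2 → coeff (r + m) P = 0)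
    {n₀ : Fin 4 →₀ ℕ} (hn₀ : n₀.degree ≤ 6) (hn₀a : n₀ a ≤ 1) (hn₀ν : n₀ ν ≤ 1) (hM : 10 ≤ M)
    (H4 : ∀ m₀ : Fin 4 →₀ ℕ, m₀ ≤ n₀ → m₀ ≠ n₀ → 4 ≤ m₀.degree → coeff (r + m₀) P = 0)
    (H3 : n₀.degree = 6 → ∀ m₀ : Fin 4 →₀ ℕ, m₀ ≤ n₀ → m₀.degree = 3 →
      coeff (r + (m₀ + Finsupp.single a 1)) P = 0)
    (hQ : coeff ((r + n₀).mapDomain (Equiv.swap a f).symm) Q ≠ 0) : coeff (r + n₀) P ≠ 0 := by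
  rw [transfer_coeff haf hao haν hfν hoν hr hΘi hΘf hG1 hG3 hE hrel hdivP hZ2 hZ3 hn₀ hn₀a hn₀ν hM H4 H3] at hQ
  intro h0
  exact hQ (by rw [h0, mul_zero])

end Transfer

/-! ## §2 `s = 3` from the two canonical frames -/

section Order

variable [CharP K 5]

/-- **THE COMPOSITE CORRECTION HAS PURE-SLOT ORDER ≥ 3** (K24a-R1c; res-dim4-p-7's (b′)+(b″)).  Along the framed
swap relation, if the real child `P` (boundary `r = e_f + e_o + e_ν`, free letter `a`) is STRAIGHT (`support in
relative degree ≥ 3`, the only relative-degree-3 monomial is `x_a³`, with nonzero coefficient) and TSCHIRNHAUS in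
relative degree 4 (`coeff_{r + 2e_a + e_i + e_k} P = 0` for slot/idle letters `i, k`), and the partner `Q` is straight
and Tschirnhaus in the same sense at its free letter `f`, then every pure-slot monomial of `G` has degree `≥ 3`.
[OURS over res-dim4-p-7's `coeff_linear_eq_zero_of_straight`, `coeff_quadratic_eq_zero_of_tschirnhaus`,
`three_le_degree_of_frames`] [cite: CossartJannsenSaito2020, Thm. 3.14] -/
theorem three_le_degree_of_framed_rel {a f o ν : Fin 4} (haf : a ≠ f) (hao : a ≠ o) (haν : a ≠ ν) (hfν : f ≠ ν)
    (hoν : o ≠ ν) {P Q : MvPolynomial (Fin 4) K} {r : Fin 4 →₀ ℕ}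
    (hr : r = Finsupp.single f 1 + Finsupp.single o 1 + Finsupp.single ν 1)
    {Θ e : Fin 4 → MvPolynomial (Fin 4) K} {G U E : MvPolynomial (Fin 4) K} {M : ℕ}
    (hΘi : ∀ i, i ≠ f → Θ (Equiv.swap a f i) = X i * e i) (hΘf : Θ (Equiv.swap a f f) = X f * e f + G)
    (he : ∀ i, constantCoeff (e i) ≠ 0) (hG0 : constantCoeff G = 0) (hG1 : coeff (Finsupp.single f 1) G = 0)
    (hU : constantCoeff U ≠ 0) (hE : E ∈ originIdeal K ^ M) (hrel : Q = deletePthPowers 5 (U ^ 5 * aeval Θ P) + E)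
    (hM : 10 ≤ M)
    (hA : ∀ m ∈ P.support, r.degree + 3 ≤ m.degree)
    (hAcone : ∀ m ∈ P.support, m.degree = r.degree + 3 → m = r + Finsupp.single a 3)
    (ha : coeff (r + Finsupp.single a 3) P ≠ 0)
    (hA4 : ∀ i k, i ≠ a → k ≠ a →
      coeff (r + Finsupp.single a 2 + Finsupp.single i 1 + Finsupp.single k 1) P = 0)
    (hB : ∀ i, i ≠ f → coeff (r.mapDomain (Equiv.swap a f).symm + Finsupp.single f 2 + Finsupp.single i 1) Q = 0)
    (hB4 : ∀ i k, i ≠ f → k ≠ f →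
      coeff (r.mapDomain (Equiv.swap a f).symm + Finsupp.single f 2 + Finsupp.single i 1 + Finsupp.single k 1) Q = 0) :
    ∀ dd ∈ G.support, dd f = 0 → 3 ≤ dd.degree := by
  classical
  have hπf : Equiv.swap a f f = a := Equiv.swap_apply_right a f
  have hra : r a = 0 := by rw [hr]; simp [haf, hao, haν]
  have hrν : r ν = 1 := by rw [hr]; simp [hfν, hoν]
  have hrdeg : r.degree = 3 := by rw [hr, map_add, map_add]; simp
  have h3K : (3 : K) ≠ 0 := fun h =>
    absurd ((CharP.cast_eq_zero_iff K 5 3).mp (by exact_mod_cast h)) (by norm_num)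
  have hV : constantCoeff (U ^ 5) ≠ 0 := by rw [map_pow]; exact pow_ne_zero _ hU
  have hπi : ∀ i, i ≠ f → Equiv.swap a f i ≠ a := fun i hi h =>
    hi ((Equiv.swap a f).injective (h.trans hπf.symm))
  have hrBν : (r.mapDomain (Equiv.swap a f).symm) ν = 1 := by
    rw [mapDomain_symm_apply, Equiv.swap_apply_of_ne_of_ne haν.symm hfν.symm, hrν]
  -- hypotheses of res-dim4-p-7's lemmas, in their letters (`π f = a`)
  have hrf : r (Equiv.swap a f f) = 0 := by rw [hπf, hra]
  have hAcone' : ∀ m ∈ P.support, m.degree = r.degree + 3 → m = r + Finsupp.single (Equiv.swap a f f) 3 := by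
    rw [hπf]; exact hAcone
  have ha' : coeff (r + Finsupp.single (Equiv.swap a f f) 3) P ≠ 0 := by rw [hπf]; exact ha
  have hMl : r.degree + 3 < M := by rw [hrdeg]; omega
  have hMq : r.degree + 3 + 1 < M := by rw [hrdeg]; omega
  have hnq : ∀ i, i ≠ f → ¬ IsPthPowerExponent 5
      (r.mapDomain (Equiv.swap a f).symm + Finsupp.single f (3 - 1) + Finsupp.single i 1) := by
    intro i _
    refine not_isPthPowerExponent_of_not_dvd (i := ν) ?_
    rw [Finsupp.add_apply, Finsupp.add_apply, hrBν, Finsupp.single_apply, if_neg hfν, Finsupp.single_apply]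
    split_ifs <;> omega
  have hnq4 : ∀ i k, i ≠ f → k ≠ f → ¬ IsPthPowerExponent 5
      (r.mapDomain (Equiv.swap a f).symm + Finsupp.single f (3 - 1) + Finsupp.single i 1 + Finsupp.single k 1) := by
    intro i k _ _
    refine not_isPthPowerExponent_of_not_dvd (i := ν) ?_
    rw [Finsupp.add_apply, Finsupp.add_apply, Finsupp.add_apply, hrBν, Finsupp.single_apply, if_neg hfν,
      Finsupp.single_apply, Finsupp.single_apply]
    split_ifs <;> omega
  have hB' : ∀ i, i ≠ f →
      coeff (r.mapDomain (Equiv.swap a f).symm + Finsupp.single f (3 - 1) + Finsupp.single i 1) Q = 0 := hB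
  have hA4' : ∀ i k, i ≠ f → k ≠ f → coeff (r + Finsupp.single (Equiv.swap a f f) (3 - 1) +
      Finsupp.single (Equiv.swap a f i) 1 + Finsupp.single (Equiv.swap a f k) 1) P = 0 := by
    intro i k hi hk
    rw [hπf]
    exact hA4 _ _ (hπi i hi) (hπi k hk)
  have hB4' : ∀ i k, i ≠ f → k ≠ f → coeff (r.mapDomain (Equiv.swap a f).symm + Finsupp.single f (3 - 1) +
      Finsupp.single i 1 + Finsupp.single k 1) Q = 0 := hB4
  have hlin := SwapNorm.coeff_linear_eq_zero_of_straight 5 hΘi hΘf he hG0 hG1 hV hE hrel (d := 3) (by norm_num)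
    (by exact_mod_cast h3K) hrf hA hAcone' ha' hMl hnq hB'
  have hquad := SwapNorm.coeff_quadratic_eq_zero_of_tschirnhaus 5 hΘi hΘf he hG0 hG1 hlin hV hE hrel (d := 3)
    (by norm_num) (by exact_mod_cast h3K) hrf hA hAcone' ha' hMq hA4' hnq4 hB4'
  exact SwapNorm.three_le_degree_of_frames hG0 hlin hquad

end Order

/-! ## §3 The instances of the rotating game -/

section Instances

/-- **CLEAN TRANSFER IN RELATIVE DEGREE 4** (`hfix'`, `hmuA`, `hmuT` and the degree-4 flag members of the rotating
game): for `|n₀| = 4` (`n₀ a ≤ 1`, `n₀ ν ≤ 1`) no shadow of relative degree `≥ 4` exists, so a nonzero partner reading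
at `(r + n₀)♭` gives a nonzero real-child reading at `r + n₀`. [OURS] [cite: CossartJannsenSaito2020, Thm. 3.14] -/
theorem transfer_deg_four {a f o ν : Fin 4} (haf : a ≠ f) (hao : a ≠ o) (haν : a ≠ ν) (hfν : f ≠ ν) (hoν : o ≠ ν)
    {P Q : MvPolynomial (Fin 4) K} {r : Fin 4 →₀ ℕ}
    (hr : r = Finsupp.single f 1 + Finsupp.single o 1 + Finsupp.single ν 1)
    {Θ e : Fin 4 → MvPolynomial (Fin 4) K} {G U E : MvPolynomial (Fin 4) K} {M : ℕ}
    (hΘi : ∀ i, i ≠ f → Θ (Equiv.swap a f i) = X i * e i) (hΘf : Θ (Equiv.swap a f f) = X f * e f + G)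
    (hG1 : coeff (Finsupp.single f 1) G = 0) (hG3 : ∀ dd ∈ G.support, dd f = 0 → 3 ≤ dd.degree)
    (hE : E ∈ originIdeal K ^ M) (hrel : Q = deletePthPowers 5 (U ^ 5 * aeval Θ P) + E)
    (hdivP : ∀ m ∈ P.support, r ≤ m) (hZ2 : ∀ m : Fin 4 →₀ ℕ, m.degree ≤ 2 → coeff (r + m) P = 0)
    (hZ3 : ∀ m : Fin 4 →₀ ℕ, m.degree = 3 → m a ≤ 2 → coeff (r + m) P = 0)
    {n₀ : Fin 4 →₀ ℕ} (hn₀ : n₀.degree = 4) (hn₀a : n₀ a ≤ 1) (hn₀ν : n₀ ν ≤ 1) (hM : 10 ≤ M)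
    (hQ : coeff ((r + n₀).mapDomain (Equiv.swap a f).symm) Q ≠ 0) : coeff (r + n₀) P ≠ 0 :=
  transfer_ne haf hao haν hfν hoν hr hΘi hΘf hG1 hG3 hE hrel hdivP hZ2 hZ3 (by omega) hn₀a hn₀ν hM
    (fun _ hm hne h4 => absurd (FrameChange.eq_of_le_of_degree_le hm (by rw [hn₀]; exact h4)) hne)
    (fun h6 => absurd (hn₀.symm.trans h6) (by norm_num)) hQ

/-- **TRANSFER OF `x_x²x_y³`** (`hfix`, `hmuB` and the degree-5 flag member): given the legality zero at `2x+2y`,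
a nonzero partner reading at `(r + 2e_x + 3e_y)♭` gives `coeff_{r+2e_x+3e_y} P ≠ 0` OR the live shadow
`coeff_{r+e_x+3e_y} P ≠ 0`. [OURS] [cite: CossartJannsenSaito2020, Thm. 3.14] -/
theorem transfer_two_three {a f o ν : Fin 4} (haf : a ≠ f) (hao : a ≠ o) (haν : a ≠ ν) (hfν : f ≠ ν) (hoν : o ≠ ν)
    {x y : Fin 4} (hxy : x ≠ y) (hxa : x ≠ a) (hya : y ≠ a) (hxν : x ≠ ν) (hyν : y ≠ ν)
    {P Q : MvPolynomial (Fin 4) K} {r : Fin 4 →₀ ℕ}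
    (hr : r = Finsupp.single f 1 + Finsupp.single o 1 + Finsupp.single ν 1)
    {Θ e : Fin 4 → MvPolynomial (Fin 4) K} {G U E : MvPolynomial (Fin 4) K} {M : ℕ}
    (hΘi : ∀ i, i ≠ f → Θ (Equiv.swap a f i) = X i * e i) (hΘf : Θ (Equiv.swap a f f) = X f * e f + G)
    (hG1 : coeff (Finsupp.single f 1) G = 0) (hG3 : ∀ dd ∈ G.support, dd f = 0 → 3 ≤ dd.degree)
    (hE : E ∈ originIdeal K ^ M) (hrel : Q = deletePthPowers 5 (U ^ 5 * aeval Θ P) + E)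
    (hdivP : ∀ m ∈ P.support, r ≤ m) (hZ2 : ∀ m : Fin 4 →₀ ℕ, m.degree ≤ 2 → coeff (r + m) P = 0)
    (hZ3 : ∀ m : Fin 4 →₀ ℕ, m.degree = 3 → m a ≤ 2 → coeff (r + m) P = 0) (hM : 10 ≤ M)
    (hZ22 : coeff (r + (Finsupp.single x 2 + Finsupp.single y 2)) P = 0)
    (hQ : coeff ((r + (Finsupp.single x 2 + Finsupp.single y 3)).mapDomain (Equiv.swap a f).symm) Q ≠ 0) :
    coeff (r + (Finsupp.single x 2 + Finsupp.single y 3)) P ≠ 0 ∨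
      coeff (r + (Finsupp.single x 1 + Finsupp.single y 3)) P ≠ 0 := by
  by_contra h
  push Not at h
  obtain ⟨h23, h13⟩ := h
  refine transfer_ne haf hao haν hfν hoν hr hΘi hΘf hG1 hG3 hE hrel hdivP hZ2 hZ3
    (n₀ := Finsupp.single x 2 + Finsupp.single y 3)
    (by rw [map_add, Finsupp.degree_single, Finsupp.degree_single]; norm_num) (by simp [hxa, hya])
    (by simp [hxν, hyν]) hM (fun m₀ hm hne h4 => ?_)
    (fun h6 => absurd h6 (by rw [map_add, Finsupp.degree_single, Finsupp.degree_single]; norm_num)) hQ h23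
  obtain ⟨hm₀, hx, hy⟩ := eq_of_le_two_single hxy hm
  have hd : m₀.degree = m₀ x + m₀ y := by
    conv_lhs => rw [hm₀]
    rw [map_add, Finsupp.degree_single, Finsupp.degree_single]
  rcases (by omega : (m₀ x = 1 ∧ m₀ y = 3) ∨ (m₀ x = 2 ∧ m₀ y = 2) ∨ (m₀ x = 2 ∧ m₀ y = 3)) with
    ⟨h1, h2⟩ | ⟨h1, h2⟩ | ⟨h1, h2⟩
  · rw [hm₀, h1, h2]; exact h13
  · rw [hm₀, h1, h2]; exact hZ22
  · exact absurd (by rw [hm₀, h1, h2]) hne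

/-- **TRANSFER OF `x_x²x_y⁴`** (the degree-6 flag member): given the legality zero at `2x+2y` and the ledger zeros
at `4y` and `Y+3y` (`Y = x_a`), a nonzero partner reading at `(r + 2e_x + 4e_y)♭` gives `coeff_{r+2e_x+4e_y} P ≠ 0`
OR one of the five live shadows `x+3y`, `x+4y`, `2x+3y`, `Y+x+2y`, `Y+2x+y`. [OURS]
[cite: CossartJannsenSaito2020, Thm. 3.14] -/
theorem transfer_two_four {a f o ν : Fin 4} (haf : a ≠ f) (hao : a ≠ o) (haν : a ≠ ν) (hfν : f ≠ ν) (hoν : o ≠ ν)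
    {x y : Fin 4} (hxy : x ≠ y) (hxa : x ≠ a) (hya : y ≠ a) (hxν : x ≠ ν) (hyν : y ≠ ν)
    {P Q : MvPolynomial (Fin 4) K} {r : Fin 4 →₀ ℕ}
    (hr : r = Finsupp.single f 1 + Finsupp.single o 1 + Finsupp.single ν 1)
    {Θ e : Fin 4 → MvPolynomial (Fin 4) K} {G U E : MvPolynomial (Fin 4) K} {M : ℕ}
    (hΘi : ∀ i, i ≠ f → Θ (Equiv.swap a f i) = X i * e i) (hΘf : Θ (Equiv.swap a f f) = X f * e f + G)
    (hG1 : coeff (Finsupp.single f 1) G = 0) (hG3 : ∀ dd ∈ G.support, dd f = 0 → 3 ≤ dd.degree)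
    (hE : E ∈ originIdeal K ^ M) (hrel : Q = deletePthPowers 5 (U ^ 5 * aeval Θ P) + E)
    (hdivP : ∀ m ∈ P.support, r ≤ m) (hZ2 : ∀ m : Fin 4 →₀ ℕ, m.degree ≤ 2 → coeff (r + m) P = 0)
    (hZ3 : ∀ m : Fin 4 →₀ ℕ, m.degree = 3 → m a ≤ 2 → coeff (r + m) P = 0) (hM : 10 ≤ M)
    (hZ22 : coeff (r + (Finsupp.single x 2 + Finsupp.single y 2)) P = 0)
    (hZ04 : coeff (r + Finsupp.single y 4) P = 0)
    (hZa3 : coeff (r + (Finsupp.single y 3 + Finsupp.single a 1)) P = 0)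
    (hQ : coeff ((r + (Finsupp.single x 2 + Finsupp.single y 4)).mapDomain (Equiv.swap a f).symm) Q ≠ 0) :
    coeff (r + (Finsupp.single x 2 + Finsupp.single y 4)) P ≠ 0 ∨
      coeff (r + (Finsupp.single x 1 + Finsupp.single y 3)) P ≠ 0 ∨
      coeff (r + (Finsupp.single x 1 + Finsupp.single y 4)) P ≠ 0 ∨
      coeff (r + (Finsupp.single x 2 + Finsupp.single y 3)) P ≠ 0 ∨
      coeff (r + (Finsupp.single x 1 + Finsupp.single y 2 + Finsupp.single a 1)) P ≠ 0 ∨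
      coeff (r + (Finsupp.single x 2 + Finsupp.single y 1 + Finsupp.single a 1)) P ≠ 0 := by
  by_contra h
  push Not at h
  obtain ⟨h24, h13, h14, h23, h12a, h21a⟩ := h
  refine transfer_ne haf hao haν hfν hoν hr hΘi hΘf hG1 hG3 hE hrel hdivP hZ2 hZ3
    (n₀ := Finsupp.single x 2 + Finsupp.single y 4)
    (by rw [map_add, Finsupp.degree_single, Finsupp.degree_single]) (by simp [hxa, hya])
    (by simp [hxν, hyν]) hM (fun m₀ hm hne h4 => ?_) (fun _ m₀ hm h3 => ?_) hQ h24
  · obtain ⟨hm₀, hx, hy⟩ := eq_of_le_two_single hxy hm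
    have hd : m₀.degree = m₀ x + m₀ y := by
      conv_lhs => rw [hm₀]
      rw [map_add, Finsupp.degree_single, Finsupp.degree_single]
    rcases (by omega : (m₀ x = 0 ∧ m₀ y = 4) ∨ (m₀ x = 1 ∧ m₀ y = 3) ∨ (m₀ x = 2 ∧ m₀ y = 2) ∨
      (m₀ x = 1 ∧ m₀ y = 4) ∨ (m₀ x = 2 ∧ m₀ y = 3) ∨ (m₀ x = 2 ∧ m₀ y = 4)) with
      ⟨h1, h2⟩ | ⟨h1, h2⟩ | ⟨h1, h2⟩ | ⟨h1, h2⟩ | ⟨h1, h2⟩ | ⟨h1, h2⟩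
    · rw [hm₀, h1, h2, Finsupp.single_zero, zero_add]; exact hZ04
    · rw [hm₀, h1, h2]; exact h13
    · rw [hm₀, h1, h2]; exact hZ22
    · rw [hm₀, h1, h2]; exact h14
    · rw [hm₀, h1, h2]; exact h23
    · exact absurd (by rw [hm₀, h1, h2]) hne
  · obtain ⟨hm₀, hx, hy⟩ := eq_of_le_two_single hxy hm
    have hd : m₀.degree = m₀ x + m₀ y := by
      conv_lhs => rw [hm₀]
      rw [map_add, Finsupp.degree_single, Finsupp.degree_single]
    rcases (by omega : (m₀ x = 0 ∧ m₀ y = 3) ∨ (m₀ x = 1 ∧ m₀ y = 2) ∨ (m₀ x = 2 ∧ m₀ y = 1)) with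
      ⟨h1, h2⟩ | ⟨h1, h2⟩ | ⟨h1, h2⟩
    · rw [hm₀, h1, h2, Finsupp.single_zero, zero_add]; exact hZa3
    · rw [hm₀, h1, h2]; exact h12a
    · rw [hm₀, h1, h2]; exact h21a

end Instances

end ResCone

end Summit.ResolutionOfSingularities.ResolutionOfSingularities.Theorems.PIDim4

end
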